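import Literature.RepresentationTheory.HeisenbergGroup.MetaplecticSumStrippingRight
import Literature.RepresentationTheory.HeisenbergGroup.DoubledDeltaDiagonalInvariance
import HarnessLib

/-!
# Block-diagonal endomorphisms of a direct sum of symplectic spaces `W_T = W_{T₁} ⊕ W_{T₂}`

Topic `RepresentationTheory/HeisenbergGroup`; theorems only (no definition, no named fact).  Generic linear algebra for
the doubled symplectic space of the tree (`SchrodingerDirectSum`: `splitW e : W_T ≃ W_{T₁} × W_{T₂}`, `glue`, `inlW`,
`inrW`, `spInl`, `spInr` for `T = reindex e e (T₁ ⊕ T₂)`): an endomorphism `D` of `W_T` which is BLOCK DIAGONAL,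
`D = splitW⁻¹ ∘ (A × B) ∘ splitW` (hypothesis `hD`), inherits from its blocks

* the action on glued vectors and `D² = 0` (`blockEnd_apply_glue`, `blockEnd_comp_self_eq_zero`);
* the product formula `(g₁ ⊕ 1)(1 ⊕ g₂) = 1 + t D` for `gᵢ = 1 + t (A|B)` (`inlW_mul_inrW_apply_of_blocks`);
* `dim im D = dim im A + dim im B` (`finrank_range_blockEnd`);
* the splitting of the commutator form `A_T = A_{T₁} ⊕ A_{T₂}` along `splitW` (`alt_polar_eq_blocks`) and with it
  skewness (`alt_polar_blockEnd_skew`) and the duality of images (`disjoint_range_blockEnd_orthogonal`) block by block;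
* the sign change of the Gram matrix: `A_{−T} = −A_T`, same orthogonals (`alt_polar_gram_neg`, `mem_orthogonal_alt_polar_gram_neg_iff`);
* isotropy of `im D` from skewness and `D² = 0` (`alt_polar_range_range_eq_zero`).

Use (cell `hodgecm-mathlib`, row IV-4(c1) `rankOne_theta_lines_disjoint`, piece P3): the doubled root nilpotent
`𝔫^⊕ = 𝔫_{δ₁}(r) ⊕ a⁻¹ 𝔫_{δ₂}(r)` of `𝕎 ⊕ 𝕎⁻` (`MoeglinVignerasWaldspurger1987/RankOneThetaLinesDoubledRootForm`).
HC_CM is proved only modulo the printed citations until rung 0 of the ladder closes.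

## References
* [Kudla1984] S. Kudla, *Seesaw dual reductive pairs* (1984), §1 (direct sums of symplectic spaces).
* [MoeglinVignerasWaldspurger1987] C. Mœglin, M.-F. Vignéras, J.-L. Waldspurger, LNM 1291 (1987), Chap. 2 II.1 Rem. (6)
  (the doubled space `W ⊕ W⁻`), Chap. 1 I.17.
-/

set_option autoImplicit false

noncomputable section

namespace Literature.RepresentationTheory.HeisenbergGroup

open Literature.NumberTheory.Automorphic Matrix

/-! ## §1 Block-diagonal endomorphisms -/

section BlockEnd

variable {K : Type*} [Field K] {ι₁ ι₂ ι : Type*} (e : ι₁ ⊕ ι₂ ≃ ι)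
  (A : ((ι₁ → K) × (ι₁ → K)) →ₗ[K] ((ι₁ → K) × (ι₁ → K))) (B : ((ι₂ → K) × (ι₂ → K)) →ₗ[K] ((ι₂ → K) × (ι₂ → K)))
  (D : ((ι → K) × (ι → K)) →ₗ[K] ((ι → K) × (ι → K)))
  (hD : ∀ w, D w = (splitW (K := K) e).symm (A (splitW e w).1, B (splitW e w).2))

include hD in
/-- The block-diagonal endomorphism `A ⊕ B` on glued vectors. [cite: Kudla1984, §1] -/
theorem blockEnd_apply_glue (a b : ι₁ → K) (a' b' : ι₂ → K) :
    D (glue e a a', glue e b b') = (glue e (A (a, b)).1 (B (a', b')).1, glue e (A (a, b)).2 (B (a', b')).2) := by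
  rw [hD, splitW_apply, resL_glue, resL_glue, resR_glue, resR_glue, splitW_symm_apply]

include hD in
/-- The blocks of `(A ⊕ B) w`. [cite: Kudla1984, §1] -/
theorem splitW_blockEnd (w : (ι → K) × (ι → K)) : splitW e (D w) = (A (splitW e w).1, B (splitW e w).2) := by
  rw [hD, LinearEquiv.apply_symm_apply]

include hD in
/-- **`(A ⊕ B)² = 0`** if `A² = 0` and `B² = 0`. [cite: MoeglinVignerasWaldspurger1987, Chap. 1 I.17] -/
theorem blockEnd_comp_self_eq_zero (hA : A ∘ₗ A = 0) (hB : B ∘ₗ B = 0) : D ∘ₗ D = 0 := by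
  refine LinearMap.ext fun w => ?_
  have h1 : A (A (splitW e w).1) = 0 := by rw [← LinearMap.comp_apply, hA, LinearMap.zero_apply]
  have h2 : B (B (splitW e w).2) = 0 := by rw [← LinearMap.comp_apply, hB, LinearMap.zero_apply]
  rw [LinearMap.comp_apply, LinearMap.zero_apply, hD (D w), splitW_blockEnd e A B D hD, h1, h2]
  exact map_zero (splitW (K := K) e).symm

/-- the blocks of `(g₁ ⊕ 1)(1 ⊕ g₂) w`. [cite: Kudla1984, §1] -/
theorem splitW_inlW_mul_inrW (g₁ : ((ι₁ → K) × (ι₁ → K)) ≃ₗ[K] ((ι₁ → K) × (ι₁ → K)))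
    (g₂ : ((ι₂ → K) × (ι₂ → K)) ≃ₗ[K] ((ι₂ → K) × (ι₂ → K))) (w : (ι → K) × (ι → K)) :
    splitW e ((inlW e g₁ * inrW e g₂) w) = (g₁ (splitW e w).1, g₂ (splitW e w).2) := by
  rw [LinearEquiv.mul_apply]
  unfold inlW inrW
  simp only [LinearEquiv.trans_apply, LinearEquiv.apply_symm_apply, LinearEquiv.prodCongr_apply, LinearEquiv.refl_apply]

include hD in
/-- **`(g₁ ⊕ 1)(1 ⊕ g₂) = 1 + t (A ⊕ B)`** when `g₁ = 1 + t A` and `g₂ = 1 + t B`: the two-embedding diagonal of a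
one-parameter unipotent group is unipotent with block-diagonal logarithm. [cite: MoeglinVignerasWaldspurger1987, Chap. 2 II.1 Rem. (6)] -/
theorem inlW_mul_inrW_apply_of_blocks (g₁ : ((ι₁ → K) × (ι₁ → K)) ≃ₗ[K] ((ι₁ → K) × (ι₁ → K)))
    (g₂ : ((ι₂ → K) × (ι₂ → K)) ≃ₗ[K] ((ι₂ → K) × (ι₂ → K))) (t : K)
    (hg₁ : ∀ w, g₁ w = w + t • A w) (hg₂ : ∀ w, g₂ w = w + t • B w) (w : (ι → K) × (ι → K)) :
    (inlW e g₁ * inrW e g₂) w = w + t • D w := by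
  apply (splitW (K := K) e).injective
  rw [splitW_inlW_mul_inrW, map_add, map_smul, splitW_blockEnd e A B D hD, hg₁, hg₂]
  rfl

end BlockEnd

section BlockRank

variable {K : Type*} [Field K] {ι₁ ι₂ ι : Type*} [Finite ι₁] [Finite ι₂] (e : ι₁ ⊕ ι₂ ≃ ι)
  (A : ((ι₁ → K) × (ι₁ → K)) →ₗ[K] ((ι₁ → K) × (ι₁ → K))) (B : ((ι₂ → K) × (ι₂ → K)) →ₗ[K] ((ι₂ → K) × (ι₂ → K)))
  (D : ((ι → K) × (ι → K)) →ₗ[K] ((ι → K) × (ι → K)))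
  (hD : ∀ w, D w = (splitW (K := K) e).symm (A (splitW e w).1, B (splitW e w).2))

include hD in
/-- **`dim im (A ⊕ B) = dim im A + dim im B`**. [cite: Kudla1984, §1] -/
theorem finrank_range_blockEnd :
    Module.finrank K (LinearMap.range D) = Module.finrank K (LinearMap.range A) + Module.finrank K (LinearMap.range B) := by
  have hDeq : D = (splitW (K := K) e).symm.toLinearMap ∘ₗ (A.prodMap B) ∘ₗ (splitW (K := K) e).toLinearMap :=
    LinearMap.ext fun w => by rw [hD]; rfl
  have hr : LinearMap.range D = ((LinearMap.range A).prod (LinearMap.range B)).map (splitW (K := K) e).symm.toLinearMap := by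
    rw [hDeq, LinearMap.range_comp, LinearMap.range_comp, LinearEquiv.range, Submodule.map_top, LinearMap.range_prodMap]
  rw [hr, LinearEquiv.finrank_map_eq]
  let ε : ((LinearMap.range A).prod (LinearMap.range B)) ≃ₗ[K] ((LinearMap.range A) × (LinearMap.range B)) :=
    { toFun := fun x => (⟨x.1.1, (Submodule.mem_prod.1 x.2).1⟩, ⟨x.1.2, (Submodule.mem_prod.1 x.2).2⟩)
      invFun := fun y => ⟨(y.1.1, y.2.1), Submodule.mem_prod.2 ⟨y.1.2, y.2.2⟩⟩
      map_add' := fun _ _ => rfl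
      map_smul' := fun _ _ => rfl
      left_inv := fun _ => rfl
      right_inv := fun _ => rfl }
  rw [ε.finrank_eq, Module.finrank_prod]

end BlockRank

/-! ## §2 The commutator form along the blocks -/

section BlockForm

variable {K : Type*} [Field K] {ι₁ ι₂ ι : Type*} [Fintype ι₁] [Fintype ι₂] [Fintype ι] [DecidableEq ι₁] [DecidableEq ι₂]
  [DecidableEq ι] (e : ι₁ ⊕ ι₂ ≃ ι) (T₁ : Matrix ι₁ ι₁ K) (T₂ : Matrix ι₂ ι₂ K) {T : Matrix ι ι K}
  (hT : T = Matrix.reindex e e (Matrix.fromBlocks T₁ 0 0 T₂))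
  (A : ((ι₁ → K) × (ι₁ → K)) →ₗ[K] ((ι₁ → K) × (ι₁ → K))) (B : ((ι₂ → K) × (ι₂ → K)) →ₗ[K] ((ι₂ → K) × (ι₂ → K)))
  (D : ((ι → K) × (ι → K)) →ₗ[K] ((ι → K) × (ι → K)))
  (hD : ∀ w, D w = (splitW (K := K) e).symm (A (splitW e w).1, B (splitW e w).2))

include hT in
/-- **The commutator form of `W_{T₁ ⊕ T₂}` splits along `splitW`**: `A_T(v, w) = A_{T₁}(v₁, w₁) + A_{T₂}(v₂, w₂)`.
[cite: Kudla1984, §1] -/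
theorem alt_polar_eq_blocks (v w : (ι → K) × (ι → K)) :
    alt (polar (Matrix.toLinearMap₂' K T)) v w =
      alt (polar (Matrix.toLinearMap₂' K T₁)) (splitW e v).1 (splitW e w).1 +
        alt (polar (Matrix.toLinearMap₂' K T₂)) (splitW e v).2 (splitW e w).2 := by
  simp only [alt_apply, polar_apply, splitW_apply, toLinearMap₂'_blocks e T₁ T₂ hT]
  ring

include hT hD in
/-- `A_T((A ⊕ B) v, w) = A_{T₁}(A v₁, w₁) + A_{T₂}(B v₂, w₂)`. [cite: Kudla1984, §1] -/
theorem alt_polar_blockEnd_left (v w : (ι → K) × (ι → K)) :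
    alt (polar (Matrix.toLinearMap₂' K T)) (D v) w =
      alt (polar (Matrix.toLinearMap₂' K T₁)) (A (splitW e v).1) (splitW e w).1 +
        alt (polar (Matrix.toLinearMap₂' K T₂)) (B (splitW e v).2) (splitW e w).2 := by
  rw [alt_polar_eq_blocks e T₁ T₂ hT, splitW_blockEnd e A B D hD]

include hT hD in
/-- `A_T(v, (A ⊕ B) w) = A_{T₁}(v₁, A w₁) + A_{T₂}(v₂, B w₂)`. [cite: Kudla1984, §1] -/
theorem alt_polar_blockEnd_right (v w : (ι → K) × (ι → K)) :
    alt (polar (Matrix.toLinearMap₂' K T)) v (D w) =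
      alt (polar (Matrix.toLinearMap₂' K T₁)) (splitW e v).1 (A (splitW e w).1) +
        alt (polar (Matrix.toLinearMap₂' K T₂)) (splitW e v).2 (B (splitW e w).2) := by
  rw [alt_polar_eq_blocks e T₁ T₂ hT, splitW_blockEnd e A B D hD]

include hT hD in
/-- **Skewness of `A ⊕ B`** for `A_T` from the skewness of the blocks. [cite: MoeglinVignerasWaldspurger1987, Chap. 1 I.17] -/
theorem alt_polar_blockEnd_skew
    (hA : ∀ v w, alt (polar (Matrix.toLinearMap₂' K T₁)) (A v) w = - alt (polar (Matrix.toLinearMap₂' K T₁)) v (A w))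
    (hB : ∀ v w, alt (polar (Matrix.toLinearMap₂' K T₂)) (B v) w = - alt (polar (Matrix.toLinearMap₂' K T₂)) v (B w))
    (v w : (ι → K) × (ι → K)) :
    alt (polar (Matrix.toLinearMap₂' K T)) (D v) w = - alt (polar (Matrix.toLinearMap₂' K T)) v (D w) := by
  rw [alt_polar_blockEnd_left e T₁ T₂ hT A B D hD, alt_polar_blockEnd_right e T₁ T₂ hT A B D hD, hA, hB, neg_add]

include hT hD in
/-- **Duality of images passes to the sum**: if `im A` meets the `A_{T₁}`-orthogonal of `im A'` trivially and `im B` the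
`A_{T₂}`-orthogonal of `im B'`, then `im (A ⊕ B)` meets the `A_T`-orthogonal of `im (A' ⊕ B')` trivially.
[cite: MoeglinVignerasWaldspurger1987, Chap. 1 I.17] -/
theorem disjoint_range_blockEnd_orthogonal
    (A' : ((ι₁ → K) × (ι₁ → K)) →ₗ[K] ((ι₁ → K) × (ι₁ → K))) (B' : ((ι₂ → K) × (ι₂ → K)) →ₗ[K] ((ι₂ → K) × (ι₂ → K)))
    (D' : ((ι → K) × (ι → K)) →ₗ[K] ((ι → K) × (ι → K)))
    (hD' : ∀ w, D' w = (splitW (K := K) e).symm (A' (splitW e w).1, B' (splitW e w).2))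
    (hA : Disjoint (LinearMap.range A)
      (LinearMap.BilinForm.orthogonal (alt (polar (Matrix.toLinearMap₂' K T₁))) (LinearMap.range A')))
    (hB : Disjoint (LinearMap.range B)
      (LinearMap.BilinForm.orthogonal (alt (polar (Matrix.toLinearMap₂' K T₂))) (LinearMap.range B'))) :
    Disjoint (LinearMap.range D)
      (LinearMap.BilinForm.orthogonal (alt (polar (Matrix.toLinearMap₂' K T))) (LinearMap.range D')) := by
  rw [Submodule.disjoint_def] at hA hB ⊢
  intro x hx hxo
  obtain ⟨u, rfl⟩ := LinearMap.mem_range.1 hx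
  rw [LinearMap.BilinForm.mem_orthogonal_iff] at hxo
  have h1 : A (splitW e u).1 = 0 := by
    refine hA _ (LinearMap.mem_range_self A _) ((LinearMap.BilinForm.mem_orthogonal_iff).2 fun n hn => ?_)
    obtain ⟨s, rfl⟩ := LinearMap.mem_range.1 hn
    have := hxo (D' ((splitW (K := K) e).symm (s, 0))) (LinearMap.mem_range_self D' _)
    rw [alt_polar_blockEnd_left e T₁ T₂ hT A' B' D' hD'] at this
    simp only [LinearEquiv.apply_symm_apply, splitW_blockEnd e A B D hD, map_zero,
      LinearMap.zero_apply, add_zero] at this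
    exact this
  have h2 : B (splitW e u).2 = 0 := by
    refine hB _ (LinearMap.mem_range_self B _) ((LinearMap.BilinForm.mem_orthogonal_iff).2 fun n hn => ?_)
    obtain ⟨s, rfl⟩ := LinearMap.mem_range.1 hn
    have := hxo (D' ((splitW (K := K) e).symm (0, s))) (LinearMap.mem_range_self D' _)
    rw [alt_polar_blockEnd_left e T₁ T₂ hT A' B' D' hD'] at this
    simp only [LinearEquiv.apply_symm_apply, splitW_blockEnd e A B D hD, map_zero,
      LinearMap.zero_apply, zero_add] at this
    exact this
  rw [hD, h1, h2]
  exact map_zero (splitW (K := K) e).symm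

end BlockForm

/-! ## §3 Sign change of the Gram matrix; isotropic images -/

section GramNeg

variable {K : Type*} [Field K] {ι : Type*} [Fintype ι] [DecidableEq ι] (M : Matrix ι ι K)

/-- **`A_{−M} = −A_M`**: negating the Gram matrix negates the commutator form (`W⁻`). [cite: MoeglinVignerasWaldspurger1987, Chap. 2 II.1 Rem. (6)] -/
theorem alt_polar_gram_neg (v w : (ι → K) × (ι → K)) :
    alt (polar (Matrix.toLinearMap₂' K (-M))) v w = - alt (polar (Matrix.toLinearMap₂' K M)) v w := by
  simp only [alt_apply, polar_apply, map_neg, LinearMap.neg_apply]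
  ring

/-- `W⁻` has the same orthogonals as `W`. [cite: MoeglinVignerasWaldspurger1987, Chap. 2 II.1 Rem. (6)] -/
theorem orthogonal_alt_polar_gram_neg (N : Submodule K ((ι → K) × (ι → K))) :
    LinearMap.BilinForm.orthogonal (alt (polar (Matrix.toLinearMap₂' K (-M)))) N =
      LinearMap.BilinForm.orthogonal (alt (polar (Matrix.toLinearMap₂' K M))) N := by
  ext x
  simp only [LinearMap.BilinForm.mem_orthogonal_iff]
  refine forall₂_congr fun n _ => ?_
  change alt (polar (Matrix.toLinearMap₂' K (-M))) n x = 0 ↔ alt (polar (Matrix.toLinearMap₂' K M)) n x = 0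
  rw [alt_polar_gram_neg, neg_eq_zero]

/-- skewness is insensitive to the sign of the Gram matrix and to scalars: `A_{−M}((a 𝔫) v, w) = −A_{−M}(v, (a 𝔫) w)` from
the same for `A_M` and `𝔫`. [cite: MoeglinVignerasWaldspurger1987, Chap. 1 I.17] -/
theorem alt_polar_gram_neg_smul_skew {𝔫 : ((ι → K) × (ι → K)) →ₗ[K] ((ι → K) × (ι → K))}
    (h : ∀ v w, alt (polar (Matrix.toLinearMap₂' K M)) (𝔫 v) w = - alt (polar (Matrix.toLinearMap₂' K M)) v (𝔫 w)) (a : K)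
    (v w : (ι → K) × (ι → K)) :
    alt (polar (Matrix.toLinearMap₂' K (-M))) ((a • 𝔫) v) w = - alt (polar (Matrix.toLinearMap₂' K (-M))) v ((a • 𝔫) w) := by
  rw [alt_polar_gram_neg, alt_polar_gram_neg, LinearMap.smul_apply, LinearMap.smul_apply, LinearMap.map_smul₂, map_smul, h,
    smul_eq_mul, smul_eq_mul, mul_neg]

/-- duality of images is insensitive to the sign of the Gram matrix and to non-zero scalars. [cite: MoeglinVignerasWaldspurger1987, Chap. 1 I.17] -/
theorem disjoint_range_smul_orthogonal_gram_neg {𝔫 𝔫' : ((ι → K) × (ι → K)) →ₗ[K] ((ι → K) × (ι → K))}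
    (h : Disjoint (LinearMap.range 𝔫) (LinearMap.BilinForm.orthogonal (alt (polar (Matrix.toLinearMap₂' K M))) (LinearMap.range 𝔫')))
    {a : K} (ha : a ≠ 0) :
    Disjoint (LinearMap.range (a • 𝔫))
      (LinearMap.BilinForm.orthogonal (alt (polar (Matrix.toLinearMap₂' K (-M)))) (LinearMap.range (a • 𝔫'))) := by
  rwa [LinearMap.range_smul _ _ ha, LinearMap.range_smul _ _ ha, orthogonal_alt_polar_gram_neg]

end GramNeg

section Isotropic

variable {K : Type*} [Field K] {V : Type*} [AddCommGroup V] [Module K V] (Af : V →ₗ[K] V →ₗ[K] K)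

/-- **the image of a skew nilpotent of square zero is isotropic**: `A(𝔫 v, 𝔫 w) = −A(v, 𝔫² w) = 0`.
[cite: MoeglinVignerasWaldspurger1987, Chap. 1 I.17] -/
theorem apply_range_range_eq_zero_of_skew {𝔫 : V →ₗ[K] V} (hskew : ∀ v w, Af (𝔫 v) w = - Af v (𝔫 w)) (hsq : 𝔫 ∘ₗ 𝔫 = 0) :
    ∀ p ∈ LinearMap.range 𝔫, ∀ q ∈ LinearMap.range 𝔫, Af p q = 0 := by
  rintro _ ⟨v, rfl⟩ _ ⟨w, rfl⟩
  have h0 : 𝔫 (𝔫 w) = 0 := by rw [← LinearMap.comp_apply, hsq, LinearMap.zero_apply]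
  rw [hskew, h0, map_zero, neg_zero]

/-- the kernel of a skew endomorphism is orthogonal to its image: `A(𝔫 v, w) = −A(v, 𝔫 w) = 0` for `𝔫 w = 0`.
[cite: MoeglinVignerasWaldspurger1987, Chap. 1 I.17] -/
theorem ker_le_orthogonal_range_of_skew {𝔫 : V →ₗ[K] V} (hskew : ∀ v w, Af (𝔫 v) w = - Af v (𝔫 w)) :
    LinearMap.ker 𝔫 ≤ LinearMap.BilinForm.orthogonal Af (LinearMap.range 𝔫) := by
  intro w hw
  rw [LinearMap.BilinForm.mem_orthogonal_iff]
  rintro _ ⟨v, rfl⟩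
  change Af (𝔫 v) w = 0
  rw [hskew, LinearMap.mem_ker.1 hw, map_zero, neg_zero]

end Isotropic

end Literature.RepresentationTheory.HeisenbergGroup

end
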